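import Mathlib.Algebra.Homology.DerivedCategory.Ext.ExactSequences
import Mathlib.Algebra.Homology.DerivedCategory.Ext.Map
import HarnessLib

/-!
# `Ext¹(N, X)` through a presentation `0 → N₁ → P → N → 0`: the boundary of a homomorphism
# `N₁ → X`, its kernel (extendable homomorphisms), its surjectivity when `Ext¹(P, X) = 0`, and the
# `Hom`-level diagram chase behind Milne's proof of *ADT* I Thm. 4.10

Topic `Algebra/Homology`; namespace `Literature.Algebra.Homology.ExtPresentation`.  One definition with
body (`boundary`, an `AddMonoidHom`) and theorems, for Mathlib's `Abelian.Ext` in any abelian category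
with `HasExt`; no named fact, no instance, no `sorry`.

THE MATHEMATICS (Cartan–Eilenberg / Weibel: dimension shifting in the first variable).  Let
`S : 0 → N₁ —ι→ P —π→ N → 0` be short exact (a "presentation" of `N`) and `X` an object.  The
contravariant long exact sequence of `Ext(–, X)` begins
`0 → Hom(N, X) → Hom(P, X) → Hom(N₁, X) —∂→ Ext¹(N, X) → Ext¹(P, X)`, with
`∂ f = [S] ∘ f` (Yoneda product with the class `[S] ∈ Ext¹(N, N₁)`).  Hence:
* `∂ f = 0` iff `f` extends to `P` (`boundary_eq_zero_iff`);
* if `Ext¹(P, X) = 0` then `∂` is onto: `Ext¹(N, X) ≅ Hom(N₁, X) / ι^* Hom(P, X)` (`boundary_surjective`);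
* `∂` is natural in `X` (`boundary_comp`) and `y ∘ ∂ f = (y ∘ [S]) ∘ f` for every `y ∈ Extⁿ(T, N)`
  (`comp_boundary`) — the Yoneda pairing against a boundary is a pairing against the connecting class
  `y ∘ [S] ∈ Extⁿ⁺¹(T, N₁)` pushed forward along `f`, i.e. it is computed in bidegree `(0, n+1)`;
* `∂` commutes with exact functors (`boundary_map`).
For a second short exact sequence `T : 0 → X₁ —f→ X₂ —g→ X₃ → 0` ("coefficients") with
`Ext¹(P, X₁) = 0`: `Hom(P, X₂) → Hom(P, X₃)` is onto (`comp_g_surjective`), and THE CHASE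
(`exists_eq_add_of_boundary_comp_eq_zero`): if `u : N₁ → X₂` has `∂(u ≫ g) = 0` in `Ext¹(N, X₃)` then
`u = h ≫ f + ι ≫ q` for some `h : N₁ → X₁`, `q : P → X₂` — so `∂ u = (∂ h) ∘ f` comes from `Ext¹(N, X₁)`
and, at `Hom` level, `u` and `h ≫ f` have the same restriction-free "readouts".

USE (Route A of crux `stmt-BirchSwinnertonDyer-19295`, cell `bsd-schneider-ideate`, door-c6 gen 16, the
"presentation road" to Milne I Lemma 4.13 / Thm. 4.10): `S` = door-c4's free presentation
`0 → M₁ → Inf ℤ[Γ/U]ⁿ → M^D → 0` (`DiscreteRep.freePresentation_shortExact`), `T` = door-c5's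
`0 → F̄ˣ → J̄ → C̄ → 0` (`ideleClassLimitShortComplex_shortExact`); `Ext¹(Inf ℤ[Γ/U]ⁿ, ·)` vanishes on
`F̄ˣ`, `J̄`, `C̄` (Hilbert 90 / its idèle version / axiom I at the layers), so every class of
`Ext¹(M^D, J̄)` is `∂ u` for an equivariant homomorphism `u : M₁ → J̄`, and the hypothesis
"`∂(u ≫ g) = 0`" is what the injectivity of Tate's `α¹(Γ_K, M^D)` (door-c4 `adjointMap_one_injective`)
delivers from "pairs trivially with `H¹(K, M^D)`" (`ExtDualityKernelImage`).
HONEST FRAMING: homological algebra only; no arithmetic statement is proved here.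

## References
* C. A. Weibel, *An introduction to homological algebra* (1994), §2.7 (dimension shifting), Thm. 2.7.6,
  §3.4 (Yoneda `Ext`, Vista 3.4.6). [Weibel1994]
* J. S. Milne, *Arithmetic Duality Theorems* (2nd ed. 2006), I §0 (0.8)–(0.11), I §1 proof of Lemma 1.9
  ("Every finitely generated `G`-module `M` can be resolved …"), I §4 proof of Theorem 4.10 (p. 58). [MilneADT2006]
-/

noncomputable section

universe w w' v v' u u'

namespace Literature.Algebra.Homology

namespace ExtPresentation

open CategoryTheory CategoryTheory.Abelian

variable {C : Type u} [Category.{v} C] [Abelian C] [HasExt.{w} C]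
  {S : ShortComplex C} (hS : S.ShortExact)

/-! ## §1 The boundary `∂ : Hom(N₁, X) →+ Ext¹(N, X)` of the presentation `0 → N₁ → P → N → 0` -/

/-- **The boundary `∂_X : Hom(N₁, X) →+ Ext¹(N, X)`, `f ↦ [S] ∘ f`** (Yoneda product of the class
`[S] ∈ Ext¹(N, N₁)` of the presentation `S : 0 → N₁ → P → N → 0` with `f`): the connecting map of the
contravariant long exact `Ext(–, X)`-sequence in degree `0`. [cite: Weibel1994, §2.7 and Theorem 2.7.6] -/
def boundary (X : C) : (S.X₁ ⟶ X) →+ Ext S.X₃ X 1 where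
  toFun f := hS.extClass.comp (Ext.mk₀ f) (add_zero 1)
  map_zero' := by rw [Ext.mk₀_zero, Ext.comp_zero]
  map_add' f g := by rw [Ext.mk₀_add, Ext.comp_add]

/-- Unfolding: `∂ f = [S] ∘ f`. [cite: Weibel1994, §2.7] -/
theorem boundary_apply {X : C} (f : S.X₁ ⟶ X) :
    boundary hS X f = hS.extClass.comp (Ext.mk₀ f) (add_zero 1) := rfl

/-- **Naturality in `X`**: `∂ (f ≫ u) = (∂ f) ∘ u`. [cite: Weibel1994, §2.7] -/
theorem boundary_comp {X Y : C} (f : S.X₁ ⟶ X) (u : X ⟶ Y) :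
    boundary hS Y (f ≫ u) = (boundary hS X f).comp (Ext.mk₀ u) (add_zero 1) := by
  rw [boundary_apply, boundary_apply, ← Ext.mk₀_comp_mk₀, Ext.comp_assoc_of_third_deg_zero]

/-- A homomorphism that extends to `P` has zero boundary: `∂ (ι ≫ q) = 0`. [cite: Weibel1994, Theorem 2.7.6] -/
theorem boundary_f_comp {X : C} (q : S.X₂ ⟶ X) : boundary hS X (S.f ≫ q) = 0 := by
  rw [boundary_apply, ← Ext.mk₀_comp_mk₀, ← Ext.comp_assoc_of_third_deg_zero, hS.extClass_comp,
    Ext.zero_comp]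

/-- **Exactness at `Hom(N₁, X)`**: `∂ f = 0` iff `f` extends along `ι : N₁ → P`.
[cite: Weibel1994, Theorem 2.7.6] -/
theorem boundary_eq_zero_iff {X : C} (f : S.X₁ ⟶ X) :
    boundary hS X f = 0 ↔ ∃ q : S.X₂ ⟶ X, S.f ≫ q = f := by
  constructor
  · intro h
    obtain ⟨x₂, hx₂⟩ := Ext.contravariant_sequence_exact₁ (hS := hS) (Y := X) (Ext.mk₀ f)
      (n₁ := 1) (add_zero 1) h
    refine ⟨Ext.addEquiv₀ x₂, ?_⟩
    apply Ext.addEquiv₀.symm.injective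
    change Ext.mk₀ (S.f ≫ Ext.addEquiv₀ x₂) = Ext.mk₀ f
    rw [← Ext.mk₀_comp_mk₀, Ext.mk₀_addEquiv₀_apply, hx₂]
  · rintro ⟨q, rfl⟩
    exact boundary_f_comp hS q

/-- Two homomorphisms have the same boundary iff they differ by an extendable one.
[cite: Weibel1994, Theorem 2.7.6] -/
theorem boundary_eq_boundary_iff {X : C} (f g : S.X₁ ⟶ X) :
    boundary hS X f = boundary hS X g ↔ ∃ q : S.X₂ ⟶ X, f = g + S.f ≫ q := by
  rw [← sub_eq_zero, ← map_sub, boundary_eq_zero_iff]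
  constructor
  · rintro ⟨q, hq⟩
    exact ⟨q, by rw [hq, add_sub_cancel]⟩
  · rintro ⟨q, hq⟩
    exact ⟨q, by rw [hq, add_sub_cancel_left]⟩

/-- **Exactness at `Ext¹(N, X)`: if `Ext¹(P, X) = 0` then `∂` is onto** — every class of `Ext¹(N, X)`
is the boundary of a homomorphism `N₁ → X`. [cite: Weibel1994, Theorem 2.7.6][cite: MilneADT2006, I Lemma 1.9 (proof)] -/
theorem boundary_surjective {X : C} (hP : ∀ x : Ext S.X₂ X 1, x = 0) :
    Function.Surjective (boundary hS X) := by
  intro x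
  obtain ⟨x₁, hx₁⟩ := Ext.contravariant_sequence_exact₃ (hS := hS) (Y := X) x (hP _)
    (n₀ := 0) (add_zero 1)
  refine ⟨Ext.addEquiv₀ x₁, ?_⟩
  rw [boundary_apply, Ext.mk₀_addEquiv₀_apply, hx₁]

/-- The range of `∂` contains every class killed in `Ext¹(P, X)` (the general form of the previous
statement). [cite: Weibel1994, Theorem 2.7.6] -/
theorem exists_boundary_eq_of_comp_eq_zero {X : C} (x : Ext S.X₃ X 1)
    (hx : (Ext.mk₀ S.g).comp x (zero_add 1) = 0) : ∃ f : S.X₁ ⟶ X, boundary hS X f = x := by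
  obtain ⟨x₁, hx₁⟩ := Ext.contravariant_sequence_exact₃ (hS := hS) (Y := X) x hx (n₀ := 0) (add_zero 1)
  exact ⟨Ext.addEquiv₀ x₁, by rw [boundary_apply, Ext.mk₀_addEquiv₀_apply, hx₁]⟩

/-- **The Yoneda pairing against a boundary is computed in bidegree `(0, n+1)`**:
`y ∘ ∂ f = (y ∘ [S]) ∘ f` for `y ∈ Extⁿ(T, N)` — the class `y ∘ [S] ∈ Extⁿ⁺¹(T, N₁)` (the image of `y`
under the connecting homomorphism of `S`) pushed forward along `f`.
[cite: Weibel1994, §3.4 (Yoneda product)][cite: MilneADT2006, I Theorem 4.10 (proof)] -/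
theorem comp_boundary {T X : C} {n : ℕ} (y : Ext T S.X₃ n) (f : S.X₁ ⟶ X) :
    y.comp (boundary hS X f) (rfl : n + 1 = n + 1) =
      (y.comp hS.extClass (rfl : n + 1 = n + 1)).comp (Ext.mk₀ f) (add_zero (n + 1)) := by
  rw [boundary_apply, Ext.comp_assoc_of_third_deg_zero]

/-- Pairing form: for any additive "invariant" `inv` on `Extⁿ⁺¹(T, Y)` and `u : X → Y`,
`inv (y ∘ (∂ f ∘ u)) = inv ((y ∘ [S]) ∘ (f ≫ u))`. [cite: MilneADT2006, I Theorem 4.10 (proof)] -/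
theorem comp_boundary_comp {T X Y : C} {n : ℕ} {Q : Type w'} [AddCommGroup Q]
    (inv : Ext T Y (n + 1) →+ Q) (y : Ext T S.X₃ n) (f : S.X₁ ⟶ X) (u : X ⟶ Y) :
    inv (y.comp ((boundary hS X f).comp (Ext.mk₀ u) (add_zero 1)) rfl) =
      inv ((y.comp hS.extClass (rfl : n + 1 = n + 1)).comp (Ext.mk₀ (f ≫ u)) (add_zero (n + 1))) := by
  rw [← boundary_comp, comp_boundary]

/-! ## §2 Exact functors -/

section Map

variable {D : Type u'} [Category.{v'} D] [Abelian D] [HasExt.{w'} D] (F : C ⥤ D) [F.Additive]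
  [Limits.PreservesFiniteLimits F] [Limits.PreservesFiniteColimits F]

/-- **`∂` commutes with exact functors**: `F(∂_S f) = ∂_{F S} (F f)`.
[cite: Weibel1994, §2.7] -/
theorem boundary_map {X : C} (f : S.X₁ ⟶ X) :
    (boundary hS X f).mapExactFunctor F =
      boundary (hS.map_of_exact F) (F.obj X) (F.map f) := by
  rw [boundary_apply, boundary_apply, Ext.mapExactFunctor_comp, Ext.mapExactFunctor_extClass,
    Ext.mapExactFunctor_mk₀]
  rfl

end Map

/-! ## §3 A second short exact sequence of coefficients `0 → X₁ → X₂ → X₃ → 0`: the chase -/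

section Chase

variable {T : ShortComplex C} (hT : T.ShortExact)

include hT in
/-- **`Hom(P, X₂) → Hom(P, X₃)` is onto when `Ext¹(P, X₁) = 0`** (covariant long exact sequence of
`Hom(P, –)`). [cite: Weibel1994, Theorem 2.7.6] -/
theorem comp_g_surjective (hP : ∀ x : Ext S.X₂ T.X₁ 1, x = 0) :
    Function.Surjective fun q : S.X₂ ⟶ T.X₂ => q ≫ T.g := by
  intro q₃
  obtain ⟨x₂, hx₂⟩ := Ext.covariant_sequence_exact₃ (hS := hT) (X := S.X₂) (Ext.mk₀ q₃)
    (n₁ := 1) (zero_add 1) (hP _)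
  refine ⟨Ext.addEquiv₀ x₂, ?_⟩
  apply Ext.addEquiv₀.symm.injective
  change Ext.mk₀ (Ext.addEquiv₀ x₂ ≫ T.g) = Ext.mk₀ q₃
  rw [← Ext.mk₀_comp_mk₀, Ext.mk₀_addEquiv₀_apply, hx₂]

/-- `∂ (u ≫ g) = (∂ u) ∘ g`: the boundary of `u : N₁ → X₂` read in `X₃`.
[cite: MilneADT2006, I Theorem 4.10 (proof)] -/
theorem boundary_comp_g {u : S.X₁ ⟶ T.X₂} :
    boundary hS T.X₃ (u ≫ T.g) = (boundary hS T.X₂ u).comp (Ext.mk₀ T.g) (add_zero 1) :=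
  boundary_comp hS u T.g

include hT in
/-- **THE CHASE.**  If `Ext¹(P, X₁) = 0` and `u : N₁ → X₂` has `∂(u ≫ g) = 0` in `Ext¹(N, X₃)`, then
`u = h ≫ f + ι ≫ q` for some `h : N₁ → X₁` and `q : P → X₂`.  (Proof: `u ≫ g` extends to
`q₃ : P → X₃`; lift `q₃ = q ≫ g`; then `(u − ι ≫ q) ≫ g = 0`, so `u − ι ≫ q` factors through the
kernel `f`.)  In Milne's proof of I 4.10 this is the step "a class of `Ext¹(M^D, J̄)` that dies in
`Ext¹(M^D, C̄)` comes from `Ext¹(M^D, K̄ˣ)`", at the level of equivariant homomorphisms out of the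
relation module `M₁`. [cite: MilneADT2006, I Theorem 4.10 (proof)][cite: Weibel1994, Theorem 2.7.6] -/
theorem exists_eq_add_of_boundary_comp_eq_zero (hP : ∀ x : Ext S.X₂ T.X₁ 1, x = 0)
    (u : S.X₁ ⟶ T.X₂) (hu : boundary hS T.X₃ (u ≫ T.g) = 0) :
    ∃ (h : S.X₁ ⟶ T.X₁) (q : S.X₂ ⟶ T.X₂), u = h ≫ T.f + S.f ≫ q := by
  obtain ⟨q₃, hq₃⟩ := (boundary_eq_zero_iff hS (u ≫ T.g)).1 hu
  obtain ⟨q, hq⟩ := comp_g_surjective hT hP q₃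
  have hq' : q ≫ T.g = q₃ := hq
  haveI := hT.mono_f
  have h0 : (u - S.f ≫ q) ≫ T.g = 0 := by
    rw [Preadditive.sub_comp, Category.assoc, hq', hq₃, sub_self]
  refine ⟨hT.exact.lift (u - S.f ≫ q) h0, q, ?_⟩
  rw [hT.exact.lift_f, sub_add_cancel]

include hT in
/-- The same chase with the hypothesis in the form `(∂ u) ∘ g = 0`.
[cite: MilneADT2006, I Theorem 4.10 (proof)] -/
theorem exists_eq_add_of_boundary_comp_mk₀_eq_zero (hP : ∀ x : Ext S.X₂ T.X₁ 1, x = 0)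
    (u : S.X₁ ⟶ T.X₂) (hu : (boundary hS T.X₂ u).comp (Ext.mk₀ T.g) (add_zero 1) = 0) :
    ∃ (h : S.X₁ ⟶ T.X₁) (q : S.X₂ ⟶ T.X₂), u = h ≫ T.f + S.f ≫ q :=
  exists_eq_add_of_boundary_comp_eq_zero hS hT hP u (by rw [boundary_comp_g, hu])

include hT in
/-- Consequence for the classes: under the same hypotheses `∂ u = (∂ h) ∘ f` comes from `Ext¹(N, X₁)`.
[cite: MilneADT2006, I Theorem 4.10 (proof)] -/
theorem exists_boundary_comp_f_eq (hP : ∀ x : Ext S.X₂ T.X₁ 1, x = 0)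
    (u : S.X₁ ⟶ T.X₂) (hu : (boundary hS T.X₂ u).comp (Ext.mk₀ T.g) (add_zero 1) = 0) :
    ∃ h : S.X₁ ⟶ T.X₁, (boundary hS T.X₁ h).comp (Ext.mk₀ T.f) (add_zero 1) = boundary hS T.X₂ u := by
  obtain ⟨h, q, rfl⟩ := exists_eq_add_of_boundary_comp_mk₀_eq_zero hS hT hP u hu
  exact ⟨h, by rw [map_add, boundary_f_comp, add_zero, boundary_comp]⟩

/-- Conversely a homomorphism of the form `h ≫ f + ι ≫ q` has `∂(· ≫ g) = 0`.
[cite: MilneADT2006, I Theorem 4.10 (proof)] -/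
theorem boundary_comp_g_eq_zero_of_eq_add (h : S.X₁ ⟶ T.X₁) (q : S.X₂ ⟶ T.X₂) :
    boundary hS T.X₃ ((h ≫ T.f + S.f ≫ q) ≫ T.g) = 0 := by
  rw [Preadditive.add_comp, Category.assoc, T.zero, Limits.comp_zero, zero_add, Category.assoc,
    boundary_f_comp]

end Chase

end ExtPresentation

end Literature.Algebra.Homology

end
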